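import Summits.QuantumFields.GaugeBoot.Rows.GLYZc2D4LTab
import HarnessLib

/-!
# Gauge-boot: kernel check of the raw `link1` class table of the glyz-c2-4D problems, rows 20–39 (part 2/10)

Cell `pub-gaugeboot` (HOME `run/shared/lean/pub/pub-gaugeboot/`), seat lean1 (torus layer for rows C76–C87 = the certified
glyz-c2-4D windows: label set, raw blocks, class/witness tables, the reduction identity, per-β bindings).

HONEST FRAMING (page 1 of every file of this cell): certified bounds on lattice expectations at STATED coupling,
gauge group, dimension and torus size; NOT a mass gap, NOT a continuum limit, NOT a string tension, NOT large `N`.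
The venture is explicitly NOT Yang–Mills-summit-bearing (barriers `FixedCouplingUltralocality`,
`PerturbativeInvisibility`).

`lcanon_rows_<lo>_<hi> : ∀ i, lo ≤ i < hi → ∀ j ≥ i, GLYZc2D4.LCanonOK i j`, each range one closed computation (`decide +kernel`);
assembled in `GLYZc2D4Canon`.
-/

noncomputable section

open Literature.MathematicalPhysics.QuantumFieldTheory

namespace Summit.QuantumFields.GaugeBoot

namespace GLYZc2D4

set_option maxHeartbeats 0 in
/-- Rows `20 ≤ i < 24` of the `link1` class table of the glyz-c2-4D problems canonicalise (1258 entries; kernel). -/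
theorem lcanon_rows_20_24 : ∀ i : Fin 336, 20 ≤ i.val → i.val < 24 → ∀ j : Fin 336, i.val ≤ j.val → GLYZc2D4.LCanonOK i j := by
  decide +kernel

set_option maxHeartbeats 0 in
/-- Rows `24 ≤ i < 28` of the `link1` class table of the glyz-c2-4D problems canonicalise (1242 entries; kernel). -/
theorem lcanon_rows_24_28 : ∀ i : Fin 336, 24 ≤ i.val → i.val < 28 → ∀ j : Fin 336, i.val ≤ j.val → GLYZc2D4.LCanonOK i j := by
  decide +kernel

set_option maxHeartbeats 0 in
/-- Rows `28 ≤ i < 32` of the `link1` class table of the glyz-c2-4D problems canonicalise (1226 entries; kernel). -/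
theorem lcanon_rows_28_32 : ∀ i : Fin 336, 28 ≤ i.val → i.val < 32 → ∀ j : Fin 336, i.val ≤ j.val → GLYZc2D4.LCanonOK i j := by
  decide +kernel

set_option maxHeartbeats 0 in
/-- Rows `32 ≤ i < 36` of the `link1` class table of the glyz-c2-4D problems canonicalise (1210 entries; kernel). -/
theorem lcanon_rows_32_36 : ∀ i : Fin 336, 32 ≤ i.val → i.val < 36 → ∀ j : Fin 336, i.val ≤ j.val → GLYZc2D4.LCanonOK i j := by
  decide +kernel

set_option maxHeartbeats 0 in
/-- Rows `36 ≤ i < 40` of the `link1` class table of the glyz-c2-4D problems canonicalise (1194 entries; kernel). -/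
theorem lcanon_rows_36_40 : ∀ i : Fin 336, 36 ≤ i.val → i.val < 40 → ∀ j : Fin 336, i.val ≤ j.val → GLYZc2D4.LCanonOK i j := by
  decide +kernel

end GLYZc2D4

end Summit.QuantumFields.GaugeBoot

end
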